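import Summits.QuantumFields.BalabanUV.Beta.GAN24.LinT2ZeroMode
import Literature.MathematicalPhysics.QuantumFieldTheory.Balaban1983to89.Beta.HessianTelescopingKKT
import Literature.MathematicalPhysics.QuantumFieldTheory.Balaban1983to89.Beta.ResolventComposition
import Summits.QuantumFields.BalabanUV.Beta.GAN24.CombesThomas
import Summits.QuantumFields.BalabanUV.Beta.GAN24.MultiplierZeroMass

/-!
# `BalabanUV.Beta.GAN24.LinT2ZeroModeStep` — binder row G-an2-4 / (CONV-C), W-slot (pre-trigger; idle-seat one-shot kernel lemma
# «T2-ZERO-MODE-KERNEL*», leaf-02 gen 15): THE INSTANCE `K = KInvStep Lc j` — `ℋ♭ = −ℋᵀ` FOR THE DECIMATED COMPOSITE RESOLVENT, ITS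
# FIELD-LEG COARSE SUMS, AND THE ZERO-MODE CHARGE OF `linT2 (KInvStep Lc j) Lc T` (UNCONDITIONAL, every `j`, every `d`)

NOT IN PRINT; OUR BOOKKEEPING (G-an2-4 formalisation swarm, idle leaf seat `b2b-balaban-gan24-formalise-leaf-02`, gen 15 = test (t1) of
leaf-18 gen 15's note «T₂ ZERO MODE» made a tree theorem for an4's step kernel; module name PROVISIONAL — the row owner gan24-p1 ∕ the (P4)
author an2 may rename or re-home it).  HONEST FRAMING (cell contract, verbatim): «discharging `BetaPertH` makes Bałaban's UV stability
UNCONDITIONAL — a real constructive-QFT result; it is NOT the continuum limit and NOT the Clay problem.»  HONEST DEPENDENCY (verbatim): «continuum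
YM on T⁴ ⇐ BetaPertH ∧ nine spine estimates (0/9 proved); BetaPertH ⇐ (D1) ∧ (D4) ∧ CAP+tail; G-an2-4 gates asym, D1 and NE2/3/4.»  [folklore]
algebra over an4∕an2's DEFINED objects and THEIR tree theorems, all BY NAME: `OneStepResolventKernel.KInv` (`KInv_inr_off`, `KInv_inl_inr_off`),
`OneStepKernelFamily.dec`∕`KInvStep` (`shiftK_KInvStep`, `decays_KInvStep`), `HessianTelescopingKKT.stepCol`∕`constReproSum_stepCol`,
`KernelRepresentationSummable.constReproSum_iff_decimated`, `ResolventComposition.GamΦ_quo_eq_neg_wH`, `HessKerDressedUnits.unitK`∕`decays_unitK`,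
`GAN24.CombesThomas.sfStep`∕`smStep`, leaf-14's `GAN24.MultiplierZeroMass.hasSum_(unitK_)KInvStep_mm_left∕right`; cites nothing, mints no `def … : Prop`,
pins no colour weight, applies no unit rescaling, instantiates no wall binder, asserts NO shape of Bałaban's tables; «T2Shape» ∕ «T2SupRate» stay
LOCATED ∕ OPEN; discharges NOTHING of (hW, hWall); NOT «W-slot closed», NEVER «G-an2-4 closed»; NOT `BetaPertH`, NOT continuum, NOT Clay.

## What (generic `d`, `Lc ≥ 1`, every step `j`)

§1 `KInv_inr_inl_eq_neg` (`KInv X Y (inr α) (inl a) = −KInv Y X (inl a) (inr α)`: on the coarse sublattice `GamΦ_quo_eq_neg_wH`, off it both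
   sides vanish), `dec_inr_inl_eq_neg` (the transpose rule survives block-contour decimation), **`KInvStep_inr_inl_eq_neg`** (cf. an2's coarse-point
   forms `ResolventComposition.KInvStep_inr_inl` ∕ `KInvStep_inl_inr`).
§2 `colMass d Lc j κ l := δ_{κl}·(Lc^{j+1})^{−(d+2)}`; **`hasSum_KInvStep_col`**: `Σ'_{z′} KInvStep Lc j z (Lc•z′) (inl κ) (inr l) = colMass … κ l`
   for EVERY fine `z` (`constReproSum_stepCol` in the `y`-form, read through `shiftK_KInvStep`); **`hasSum_KInvStep_row`**:
   `Σ'_{x′} KInvStep Lc j (Lc•x′) x (inr α) (inl a) = −colMass … a α`.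
§3 **`zmode_one_linT2_KInvStep`**: for every ff-valued, jointly `Lc`-covariant `LocStencil₂` family `T` on the step-`j` lattice,
   `zmode 1 (linT2 (KInvStep Lc j) Lc T) μ ν (inl α) (inl β) = −((Lc^{j+1})^{−(d+2)})⁴ · zmode Lc T μ ν (inl α) (inl β)`
   (`GAN24/LinT2ZeroMode.zmode_one_linT2_kronecker` with `σR = (Lc^{j+1})^{−(d+2)}`, `σL = −σR`; `K`'s decay from `decays_KInvStep`).
§4 IN LEG UNITS `unitK s_f s_m (KInvStep Lc j)` (field legs × `s_f`, multiplier legs × `s_m`; `shiftK_unitK`): the factor is `−(s_f·s_m·(Lc^{j+1})^{−(d+2)})⁴`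
   (`zmode_one_linT2_unitKInvStep`); with the ADOPTED units `s_f = sfStep Lc j = Lc^j`, `s_m = smStep d Lc j = Lc^{j(d+1)}` (gan24-p1's K-slot units,
   leaf-19's `T2SlotUnits` currency) `s_f·s_m·(Lc^{j+1})^{−(d+2)} = Lc^{−(d+2)}` (`sfStep_mul_smStep_mul_colMass`), so
   **`zmode_one_linT2_unitKInvStep_step`**: the factor is `−Lc^{−4(d+2)}`, THE SAME AT EVERY `j` (divided by the `Lc^{d+1}` fine cells of a coarse cell
   this is leaf-18's density count `λ⁰ = ∓Lc^{−(d+5)}` BEFORE the colour weight `cE₂·Lc^{2(d+1)}`; d = 3, Lc = 2: `2^{−8}` = leaf-16's kit number;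
   the density normalisation and the table's own unit `unitS₂` are NOT applied here).
§5 ANY TABLE (border ∕ off-diagonal fibre slots allowed): with leaf-14's (S2c) `GAN24/MultiplierZeroMass.hasSum_KInvStep_mm_left∕right`
   (`hasSum_unitK_KInvStep_mm_left∕right`) the multiplier-leg charges vanish and the same identities hold for EVERY jointly covariant `LocStencil₂`
   family: **`zmode_one_linT2_KInvStep'`**, **`zmode_one_linT2_unitKInvStep_step'`** — the row owner's (R14-6) reading «zero mode of the transported
   table = λ·Z_ff(T) + 0» as tree theorems.
-/

noncomputable section

open Finset
open scoped BigOperators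
open Literature.MathematicalPhysics.QuantumFieldTheory
open Literature.MathematicalPhysics.QuantumFieldTheory.Balaban1983to89
open Literature.MathematicalPhysics.QuantumFieldTheory.Balaban1983to89.Beta
open Literature.Probability.LatticeModels (Torus.proj)
open LatticeForm (quo)
open ExpKernelCalculus (MKer Decays shiftK)
open OneStepResolventKernel (Fib KInv KInv_inr_off KInv_inl_inr_off)
open OneStepKernelFamily (dec legSet legW legPt LegIdx KInvStep shiftK_KInvStep decays_KInvStep)
open KernelSpecInstance (wH)
open KKTFluctuationKernel (GamΦ)
open HessianTelescopingKKT (stepCol constReproSum_stepCol)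
open KernelRepresentationSummable (constReproSum_iff_decimated)
open ResolventComposition (GamΦ_quo_eq_neg_wH)
open BalabanCompositeJets (LocStencil₂)
open Summit.QuantumFields.BalabanUV.Beta.HessKerDressedUnits (unitK unitK_apply legScale_inl legScale_inr decays_unitK)
open Summit.QuantumFields.BalabanUV.Beta.GAN24.CombesThomas (sfStep smStep)
open Summit.QuantumFields.BalabanUV.Beta.GAN24.BiStencilZeroMode (Tab zmode)
open Summit.QuantumFields.BalabanUV.Beta.GAN24.MultiplierZeroMass (hasSum_KInvStep_mm_left hasSum_KInvStep_mm_right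
  hasSum_unitK_KInvStep_mm_left hasSum_unitK_KInvStep_mm_right)
open Summit.QuantumFields.BalabanUV.Beta.GAN24.LinT2ZeroMode (linT2 zmode_one_linT2_kronecker zmode_one_linT2_kronecker')

namespace Summit.QuantumFields.BalabanUV.Beta.GAN24.LinT2ZeroModeStep

variable {d : ℕ}

/-! ## §1 The multiplier–field block of the packed resolvent is minus the transposed field–multiplier block -/

/-- [folklore] `ℋ♭ = −ℋᵀ` at the level of the packed one-step resolvent: `KInv X Y (inr α) (inl a) = −KInv Y X (inl a) (inr α)`
(on the coarse sublattice this is `ResolventComposition.GamΦ_eq_neg_wH`; off it both sides vanish). -/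
theorem KInv_inr_inl_eq_neg {N : ℕ} [NeZero N] (X Y : Fin (d + 1) → ℤ) (α a : Fin (d + 1)) :
    KInv (N := N) X Y (Sum.inr α) (Sum.inl a) = -KInv (N := N) Y X (Sum.inl a) (Sum.inr α) := by
  by_cases hx : Torus.proj N X = 0
  · have e1 : KInv (N := N) X Y (Sum.inr α) (Sum.inl a) = GamΦ (N := N) α (quo N X) a Y := by
      simp only [KInv, hx, if_true]
    have e2 : KInv (N := N) Y X (Sum.inl a) (Sum.inr α) = wH (N := N) a α (Y - X) := by
      simp only [KInv, hx, if_true]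
    rw [e1, e2, GamΦ_quo_eq_neg_wH hx]
  · rw [KInv_inr_off hx, KInv_inl_inr_off hx, neg_zero]

/-- [folklore] The same transpose rule survives the block-contour decimation `dec M`. -/
theorem dec_inr_inl_eq_neg (M : ℕ) {K : MKer (d + 1) (Fib d)} (hK : ∀ X Y α a, K X Y (Sum.inr α) (Sum.inl a) = -K Y X (Sum.inl a) (Sum.inr α))
    (x y : Fin (d + 1) → ℤ) (α a : Fin (d + 1)) :
    dec M K x y (Sum.inr α) (Sum.inl a) = -dec M K y x (Sum.inl a) (Sum.inr α) := by
  unfold dec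
  simp only [legSet, legW, legPt, Finset.sum_singleton, one_mul, mul_one]
  rw [← Finset.sum_neg_distrib]
  refine Finset.sum_congr rfl fun i _ => ?_
  rw [hK, mul_neg]

/-- [folklore] **`ℋ♭ = −ℋᵀ` FOR THE DECIMATED COMPOSITE RESOLVENT** `KInvStep Lc j`. -/
theorem KInvStep_inr_inl_eq_neg {Lc : ℕ} [NeZero Lc] (j : ℕ) (x y : Fin (d + 1) → ℤ) (α a : Fin (d + 1)) :
    KInvStep (d := d) Lc j x y (Sum.inr α) (Sum.inl a) = -KInvStep (d := d) Lc j y x (Sum.inl a) (Sum.inr α) :=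
  dec_inr_inl_eq_neg _ (fun X Y α' a' => KInv_inr_inl_eq_neg X Y α' a') x y α a

/-! ## §2 The coarse sums of the field legs of `KInvStep Lc j` -/

/-- [folklore] The coarse mass of the `(inl κ, inr l)` column of `KInvStep Lc j`: `σ_j κ l := δ_{κl} · (Lc^{j+1})^{−(d+2)}`
(an4∕an2's `HessianTelescopingKKT.constReproSum_stepCol`).  A definition asserting nothing. -/
def colMass (d Lc j : ℕ) (κ l : Fin (d + 1)) : ℝ :=
  if κ = l then ((((Lc ^ (j + 1) : ℕ) : ℝ)) ^ (d + 1 + 1))⁻¹ else 0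

/-- [folklore] **COLUMN SUMS**: for every fine point `z`, `Σ'_{z′} KInvStep Lc j z (Lc•z′) (inl κ) (inr l) = δ_{κl}·(Lc^{j+1})^{−(d+2)}` —
`constReproSum_stepCol` in the `y`-form (`KernelRepresentationSummable.constReproSum_iff_decimated`) read through block covariance
(`shiftK_KInvStep`). -/
theorem hasSum_KInvStep_col {Lc : ℕ} [NeZero Lc] (j : ℕ) (z : Fin (d + 1) → ℤ) (κ l : Fin (d + 1)) :
    HasSum (fun z' : Fin (d + 1) → ℤ => KInvStep (d := d) Lc j z ((Lc : ℤ) • z') (Sum.inl κ) (Sum.inr l)) (colMass d Lc j κ l) := by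
  unfold colMass
  have h := (constReproSum_iff_decimated (NeZero.ne Lc) _ _).1 (constReproSum_stepCol (d := d) (Lc := Lc) j κ l) (-z)
  -- `stepCol p = KInvStep (−p) 0`; at `p = −z − Lc•y` this is `KInvStep (z + Lc•y) 0 = KInvStep z (Lc•(−y))` by block covariance
  have e : ∀ y : Fin (d + 1) → ℤ, stepCol (d := d) Lc j κ l (-z - (Lc : ℤ) • y)
      = KInvStep (d := d) Lc j z ((Lc : ℤ) • (-y)) (Sum.inl κ) (Sum.inr l) := by
    intro y
    have hc := congrFun (congrFun (congrFun (congrFun (shiftK_KInvStep (Lc := Lc) (d := d) j y) (z + (Lc : ℤ) • y)) 0)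
      (Sum.inl κ)) (Sum.inr l)
    simp only [shiftK, add_neg_cancel_right, zero_add] at hc
    rw [stepCol, neg_sub, sub_neg_eq_add, add_comm, ← hc, smul_neg]
  simp_rw [e] at h
  simpa only [Equiv.neg_apply, neg_neg] using ((Equiv.neg (Fin (d + 1) → ℤ)).hasSum_iff (f := fun z' : Fin (d + 1) → ℤ =>
    KInvStep (d := d) Lc j z ((Lc : ℤ) • z') (Sum.inl κ) (Sum.inr l))).1 h

/-- [folklore] **ROW SUMS**: `Σ'_{x′} KInvStep Lc j (Lc•x′) x (inr α) (inl a) = −δ_{aα}·(Lc^{j+1})^{−(d+2)}` (column sums ⨾ transpose). -/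
theorem hasSum_KInvStep_row {Lc : ℕ} [NeZero Lc] (j : ℕ) (x : Fin (d + 1) → ℤ) (α a : Fin (d + 1)) :
    HasSum (fun x' : Fin (d + 1) → ℤ => KInvStep (d := d) Lc j ((Lc : ℤ) • x') x (Sum.inr α) (Sum.inl a)) (-colMass d Lc j a α) := by
  have e : (fun x' : Fin (d + 1) → ℤ => KInvStep (d := d) Lc j ((Lc : ℤ) • x') x (Sum.inr α) (Sum.inl a))
      = fun x' => -KInvStep (d := d) Lc j x ((Lc : ℤ) • x') (Sum.inl a) (Sum.inr α) :=
    funext fun x' => KInvStep_inr_inl_eq_neg j _ _ α a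
  rw [e]
  exact (hasSum_KInvStep_col (d := d) (Lc := Lc) j x a α).neg

/-! ## §3 The zero-mode charge of the linear second-order transport through `KInvStep Lc j` -/

/-- [folklore] **THE ZERO-MODE CHARGE OF THE LINEAR SECOND-ORDER TRANSPORT THROUGH THE DECIMATED COMPOSITE RESOLVENT.**  For every
step `j`, every ff-valued `LocStencil₂` bi-stencil family `T` on the step-`j` lattice that is jointly `Lc`-covariant, and all directions:
`zmode 1 (linT2 (KInvStep Lc j) Lc T) μ ν (inl α) (inl β) = −((Lc^{j+1})^{−(d+2)})⁴ · zmode Lc T μ ν (inl α) (inl β)` — per COARSE cell the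
charge of the transported table is `−σ_j⁴` times the charge of `T` per FINE period cell, `σ_j = (Lc^{j+1})^{−(d+2)}` the Kronecker coset mass of
the minimiser column (`constReproSum_stepCol`), the sign from `ℋ♭ = −ℋᵀ`.  No colour weight, no unit rescaling (`unitK`∕`unitS₂`), no
normalisation by the cell volume `Lc^{d+1}` is applied here — those are the consumer's bookkeeping (leaf-19's `T2SlotUnits` currency; leaf-18's
density form `λ⁰ = Lc^{d+1}·σ₀⁴`).  Unconditional: `K`'s decay, covariance and charges are tree theorems of an4∕an2. -/
theorem zmode_one_linT2_KInvStep {Lc : ℕ} [NeZero Lc] (j : ℕ) {T : Tab d} {CT δ : ℝ} (hT : LocStencil₂ T CT δ) (hδ : 0 < δ)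
    (hTcov : ∀ κ u κ' u' t, T κ (u + (Lc : ℤ) • t) κ' (u' + (Lc : ℤ) • t) = shiftK (-((Lc : ℤ) • t)) (T κ u κ' u'))
    (hTr : ∀ κ u κ' u' x z a ρ, T κ u κ' u' x z a (Sum.inr ρ) = 0) (hTl : ∀ κ u κ' u' x z ρ b, T κ u κ' u' x z (Sum.inr ρ) b = 0)
    (μ ν α β : Fin (d + 1)) :
    zmode 1 (linT2 (KInvStep (d := d) Lc j) Lc T) μ ν (Sum.inl α) (Sum.inl β)
      = -((((Lc ^ (j + 1) : ℕ) : ℝ) ^ (d + 1 + 1))⁻¹) ^ 4 * zmode Lc T μ ν (Sum.inl α) (Sum.inl β) := by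
  obtain ⟨m, C, hm, -, hK⟩ := decays_KInvStep (Lc := Lc) (d := d) j
  have h := zmode_one_linT2_kronecker (N := Lc) hK hm (fun t => shiftK_KInvStep (Lc := Lc) (d := d) j t)
    (cL := fun α' a' => -colMass d Lc j a' α') (cR := fun b' β' => colMass d Lc j b' β')
    (σL := -((((Lc ^ (j + 1) : ℕ) : ℝ) ^ (d + 1 + 1))⁻¹)) (σR := (((Lc ^ (j + 1) : ℕ) : ℝ) ^ (d + 1 + 1))⁻¹)
    (fun x α' a' => hasSum_KInvStep_row (d := d) (Lc := Lc) j x α' a') (fun z b' β' => hasSum_KInvStep_col (d := d) (Lc := Lc) j z b' β')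
    (fun α' a' => by simp only [colMass]; split_ifs <;> simp) (fun b' β' => by simp only [colMass]) hT hδ hTcov hTr hTl μ ν α β
  rw [h]
  ring

/-! ## §4 In leg units: `unitK s_f s_m (KInvStep Lc j)`; the adopted units make the factor `j`-free -/

/-- [folklore] Leg units commute with lattice shifts. -/
theorem shiftK_unitK (sf sm : ℝ) (K : MKer (d + 1) (Fib d)) (v : Fin (d + 1) → ℤ) :
    shiftK v (unitK sf sm K) = unitK sf sm (shiftK v K) := by
  funext x y a b
  simp only [shiftK, unitK_apply]

/-- [folklore] **IN LEG UNITS**: for `K = unitK s_f s_m (KInvStep Lc j)` (field legs × `s_f`, multiplier legs × `s_m`) the factor becomes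
`−(s_f·s_m·(Lc^{j+1})^{−(d+2)})⁴`. -/
theorem zmode_one_linT2_unitKInvStep {Lc : ℕ} [NeZero Lc] (j : ℕ) (sf sm : ℝ) {T : Tab d} {CT δ : ℝ} (hT : LocStencil₂ T CT δ)
    (hδ : 0 < δ) (hTcov : ∀ κ u κ' u' t, T κ (u + (Lc : ℤ) • t) κ' (u' + (Lc : ℤ) • t) = shiftK (-((Lc : ℤ) • t)) (T κ u κ' u'))
    (hTr : ∀ κ u κ' u' x z a ρ, T κ u κ' u' x z a (Sum.inr ρ) = 0) (hTl : ∀ κ u κ' u' x z ρ b, T κ u κ' u' x z (Sum.inr ρ) b = 0)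
    (μ ν α β : Fin (d + 1)) :
    zmode 1 (linT2 (unitK sf sm (KInvStep (d := d) Lc j)) Lc T) μ ν (Sum.inl α) (Sum.inl β)
      = -(sf * sm * (((Lc ^ (j + 1) : ℕ) : ℝ) ^ (d + 1 + 1))⁻¹) ^ 4 * zmode Lc T μ ν (Sum.inl α) (Sum.inl β) := by
  obtain ⟨m, C, hm, -, hK⟩ := decays_KInvStep (Lc := Lc) (d := d) j
  have hcov : ∀ t, shiftK (-((Lc : ℤ) • t)) (unitK sf sm (KInvStep (d := d) Lc j)) = unitK sf sm (KInvStep (d := d) Lc j) := fun t => by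
    rw [shiftK_unitK, shiftK_KInvStep]
  have h := zmode_one_linT2_kronecker (N := Lc) (decays_unitK hK) hm hcov
    (cL := fun α' a' => sm * -colMass d Lc j a' α' * sf) (cR := fun b' β' => sf * colMass d Lc j b' β' * sm)
    (σL := sm * -((((Lc ^ (j + 1) : ℕ) : ℝ) ^ (d + 1 + 1))⁻¹) * sf) (σR := sf * (((Lc ^ (j + 1) : ℕ) : ℝ) ^ (d + 1 + 1))⁻¹ * sm)
    (fun x α' a' => by
      simpa only [unitK_apply, legScale_inl, legScale_inr] using ((hasSum_KInvStep_row (d := d) (Lc := Lc) j x α' a').mul_left sm).mul_right sf)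
    (fun z b' β' => by
      simpa only [unitK_apply, legScale_inl, legScale_inr] using ((hasSum_KInvStep_col (d := d) (Lc := Lc) j z b' β').mul_left sf).mul_right sm)
    (fun α' a' => by simp only [colMass]; split_ifs <;> simp) (fun b' β' => by simp only [colMass]; split_ifs <;> simp) hT hδ hTcov hTr hTl μ ν α β
  rw [h]
  ring

/-- [folklore] **THE ADOPTED UNITS MAKE THE FACTOR `j`-FREE**: with `s_f = sfStep Lc j = Lc^j`, `s_m = smStep d Lc j = Lc^{j(d+1)}`
(gan24-p1's K-slot units, leaf-19's `T2SlotUnits` currency) `s_f·s_m·(Lc^{j+1})^{−(d+2)} = Lc^{−(d+2)}`. -/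
theorem sfStep_mul_smStep_mul_colMass {Lc : ℕ} [NeZero Lc] (j : ℕ) :
    sfStep Lc j * smStep d Lc j * (((Lc ^ (j + 1) : ℕ) : ℝ) ^ (d + 1 + 1))⁻¹ = ((Lc : ℝ) ^ (d + 1 + 1))⁻¹ := by
  have hL : (Lc : ℝ) ≠ 0 := Nat.cast_ne_zero.mpr (NeZero.ne Lc)
  simp only [sfStep, smStep]
  push_cast
  field_simp
  ring

/-- [folklore] **THE ZERO-MODE CHARGE OF THE LINEAR SECOND-ORDER TRANSPORT IN THE ADOPTED UNITS IS `j`-FREE**: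
`zmode 1 (linT2 (unitK (Lc^j) (Lc^{j(d+1)}) (KInvStep Lc j)) Lc T) μ ν (inl α) (inl β) = −Lc^{−4(d+2)} · zmode Lc T μ ν (inl α) (inl β)` for EVERY `j`
(leaf-18's count: per fine cell, `÷ Lc^{d+1}`, this is `∓Lc^{−(d+5)}`·(charge density of `T`); the density normalisation and the table's own
unit `unitS₂` are NOT applied here). -/
theorem zmode_one_linT2_unitKInvStep_step {Lc : ℕ} [NeZero Lc] (j : ℕ) {T : Tab d} {CT δ : ℝ} (hT : LocStencil₂ T CT δ)
    (hδ : 0 < δ) (hTcov : ∀ κ u κ' u' t, T κ (u + (Lc : ℤ) • t) κ' (u' + (Lc : ℤ) • t) = shiftK (-((Lc : ℤ) • t)) (T κ u κ' u'))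
    (hTr : ∀ κ u κ' u' x z a ρ, T κ u κ' u' x z a (Sum.inr ρ) = 0) (hTl : ∀ κ u κ' u' x z ρ b, T κ u κ' u' x z (Sum.inr ρ) b = 0)
    (μ ν α β : Fin (d + 1)) :
    zmode 1 (linT2 (unitK (sfStep Lc j) (smStep d Lc j) (KInvStep (d := d) Lc j)) Lc T) μ ν (Sum.inl α) (Sum.inl β)
      = -(((Lc : ℝ) ^ (d + 1 + 1))⁻¹) ^ 4 * zmode Lc T μ ν (Sum.inl α) (Sum.inl β) := by
  rw [zmode_one_linT2_unitKInvStep j (sfStep Lc j) (smStep d Lc j) hT hδ hTcov hTr hTl, sfStep_mul_smStep_mul_colMass]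

/-! ## §5 Any table: the off-diagonal fibre slots die on the vanishing `mm` masses ((S2c), leaf-14's `MultiplierZeroMass`) -/

/-- [folklore] **ANY `LocStencil₂` TABLE** (border∕off-diagonal fibre slots allowed): with leaf-14's (S2c) `hasSum_KInvStep_mm_left∕right` the
multiplier-leg charges of `KInvStep Lc j` vanish, so
`zmode 1 (linT2 (KInvStep Lc j) Lc T) μ ν (inl α) (inl β) = −((Lc^{j+1})^{−(d+2)})⁴ · zmode Lc T μ ν (inl α) (inl β)` for EVERY jointly covariant
`LocStencil₂` family `T` — the row owner's (R14-6) «zero mode of the transported table = λ·Z_ff(T) + 0». -/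
theorem zmode_one_linT2_KInvStep' {Lc : ℕ} [NeZero Lc] (j : ℕ) {T : Tab d} {CT δ : ℝ} (hT : LocStencil₂ T CT δ) (hδ : 0 < δ)
    (hTcov : ∀ κ u κ' u' t, T κ (u + (Lc : ℤ) • t) κ' (u' + (Lc : ℤ) • t) = shiftK (-((Lc : ℤ) • t)) (T κ u κ' u'))
    (μ ν α β : Fin (d + 1)) :
    zmode 1 (linT2 (KInvStep (d := d) Lc j) Lc T) μ ν (Sum.inl α) (Sum.inl β)
      = -((((Lc ^ (j + 1) : ℕ) : ℝ) ^ (d + 1 + 1))⁻¹) ^ 4 * zmode Lc T μ ν (Sum.inl α) (Sum.inl β) := by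
  obtain ⟨m, C, hm, -, hK⟩ := decays_KInvStep (Lc := Lc) (d := d) j
  have h := zmode_one_linT2_kronecker' (N := Lc) hK hm (fun t => shiftK_KInvStep (Lc := Lc) (d := d) j t)
    (cL := fun α' a' => match a' with | Sum.inl a'' => -colMass d Lc j a'' α' | Sum.inr _ => 0)
    (cR := fun b' β' => match b' with | Sum.inl b'' => colMass d Lc j b'' β' | Sum.inr _ => 0)
    (σL := -((((Lc ^ (j + 1) : ℕ) : ℝ) ^ (d + 1 + 1))⁻¹)) (σR := (((Lc ^ (j + 1) : ℕ) : ℝ) ^ (d + 1 + 1))⁻¹)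
    (fun x α' a' => by
      cases a' with
      | inl a'' => exact hasSum_KInvStep_row (d := d) (Lc := Lc) j x α' a''
      | inr ρ => exact hasSum_KInvStep_mm_left (Lc := Lc) j α' ρ x)
    (fun z b' β' => by
      cases b' with
      | inl b'' => exact hasSum_KInvStep_col (d := d) (Lc := Lc) j z b'' β'
      | inr ρ => exact hasSum_KInvStep_mm_right (Lc := Lc) j ρ β' z)
    (fun α' a' => by simp only [colMass]; split_ifs <;> simp) (fun b' β' => by simp only [colMass]) (fun _ _ => rfl) (fun _ _ => rfl)
    hT hδ hTcov μ ν α β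
  rw [h]
  ring

/-- [folklore] **ANY TABLE, ADOPTED UNITS, `j`-FREE**: `zmode 1 (linT2 (unitK (Lc^j) (Lc^{j(d+1)}) (KInvStep Lc j)) Lc T) μ ν (inl α) (inl β) =
−Lc^{−4(d+2)} · zmode Lc T μ ν (inl α) (inl β)` for EVERY jointly covariant `LocStencil₂` family `T` and every `j`. -/
theorem zmode_one_linT2_unitKInvStep_step' {Lc : ℕ} [NeZero Lc] (j : ℕ) {T : Tab d} {CT δ : ℝ} (hT : LocStencil₂ T CT δ)
    (hδ : 0 < δ) (hTcov : ∀ κ u κ' u' t, T κ (u + (Lc : ℤ) • t) κ' (u' + (Lc : ℤ) • t) = shiftK (-((Lc : ℤ) • t)) (T κ u κ' u'))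
    (μ ν α β : Fin (d + 1)) :
    zmode 1 (linT2 (unitK (sfStep Lc j) (smStep d Lc j) (KInvStep (d := d) Lc j)) Lc T) μ ν (Sum.inl α) (Sum.inl β)
      = -(((Lc : ℝ) ^ (d + 1 + 1))⁻¹) ^ 4 * zmode Lc T μ ν (Sum.inl α) (Sum.inl β) := by
  obtain ⟨m, C, hm, -, hK⟩ := decays_KInvStep (Lc := Lc) (d := d) j
  have hcov : ∀ t, shiftK (-((Lc : ℤ) • t)) (unitK (sfStep Lc j) (smStep d Lc j) (KInvStep (d := d) Lc j))
      = unitK (sfStep Lc j) (smStep d Lc j) (KInvStep (d := d) Lc j) := fun t => by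
    rw [shiftK_unitK, shiftK_KInvStep]
  have h := zmode_one_linT2_kronecker' (N := Lc) (decays_unitK hK) hm hcov
    (cL := fun α' a' => match a' with | Sum.inl a'' => smStep d Lc j * -colMass d Lc j a'' α' * sfStep Lc j | Sum.inr _ => 0)
    (cR := fun b' β' => match b' with | Sum.inl b'' => sfStep Lc j * colMass d Lc j b'' β' * smStep d Lc j | Sum.inr _ => 0)
    (σL := smStep d Lc j * -((((Lc ^ (j + 1) : ℕ) : ℝ) ^ (d + 1 + 1))⁻¹) * sfStep Lc j)
    (σR := sfStep Lc j * (((Lc ^ (j + 1) : ℕ) : ℝ) ^ (d + 1 + 1))⁻¹ * smStep d Lc j)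
    (fun x α' a' => by
      cases a' with
      | inl a'' =>
          simpa only [unitK_apply, legScale_inl, legScale_inr] using
            ((hasSum_KInvStep_row (d := d) (Lc := Lc) j x α' a'').mul_left (smStep d Lc j)).mul_right (sfStep Lc j)
      | inr ρ => exact hasSum_unitK_KInvStep_mm_left (Lc := Lc) _ _ j α' ρ x)
    (fun z b' β' => by
      cases b' with
      | inl b'' =>
          simpa only [unitK_apply, legScale_inl, legScale_inr] using
            ((hasSum_KInvStep_col (d := d) (Lc := Lc) j z b'' β').mul_left (sfStep Lc j)).mul_right (smStep d Lc j)
      | inr ρ => exact hasSum_unitK_KInvStep_mm_right (Lc := Lc) _ _ j ρ β' z)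
    (fun α' a' => by simp only [colMass]; split_ifs <;> simp) (fun b' β' => by simp only [colMass]; split_ifs <;> simp)
    (fun _ _ => rfl) (fun _ _ => rfl) hT hδ hTcov μ ν α β
  rw [h, ← sfStep_mul_smStep_mul_colMass (d := d) (Lc := Lc) j]
  ring

end Summit.QuantumFields.BalabanUV.Beta.GAN24.LinT2ZeroModeStep
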